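import Literature.Computability.Complexity.ProbabilisticClasses
import Literature.Computability.Complexity.Reductions
import Literature.Computability.Complexity.CountingHierarchyProofs
import Literature.Computability.Complexity.NPClosureProofs
import HarnessLib

/-!
# `BP·K` is closed under Karp reductions; `BPP`, `AM` closed downward; `coNP ⊆ AM` iff the
# complement of an NP-complete language is in `AM` (proofs; trunk CplxCore)

Sibling proof file of `ProbabilisticClasses.lean` (D-0014): structural facts about Schöning's
bounded-error operator `bp` (`BPP = bp P`, `AM = bp NP`), all PROVED from the tree's `FinTM2`
toolkit, by the same re-pairing-and-coin-truncation argument as `preimage_mem_pMajority`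
(`CountingHierarchyProofs.lean`):

* `preimage_mem_bp` — **the `BP·` operator preserves closure under polynomial-time preimages**:
  if `K` is closed under `FP` preimages then so is `bp K`. For `L ∈ bp K` with witness `L'' ∈ K`
  and coin polynomial `p`, and `f ∈ FP` with `|f x| ≤ s(|x|)`, the language `f⁻¹(L)` has the
  witness `(truncSndFn p ∘ mapFstFn f)⁻¹(L'') = {⟨x, y'⟩ | ⟨f x, y'↾p(|f x|)⟩ ∈ L''} ∈ K` and the
  coin polynomial `p ∘ s`; the fraction of correct coin strings is unchanged by the cylinder lemma
  `uniformProb_take_of_le` (Arora–Barak 2009, §7.6: "if `C ∈ BPP` and `B ≤ᵣ C` then `B ∈ BPP`",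
  here for deterministic reductions and any base class; Schöning 1989, the `BP·` operator);
* `preimage_mem_BPP`, `mem_BPP_of_karpReducible`, `NP_subset_BPP_of_isNPHard_of_mem_BPP` —
  `BPP` is closed downward under `≤ₚ`; an NP-hard language in `BPP` gives `NP ⊆ BPP`;
* `preimage_mem_AM`, `mem_AM_of_karpReducible` — `AM = BP·NP` is closed downward under `≤ₚ`
  (Arora–Barak 2009, Def. 7.17 and Remark 8.11);
* `compl_mem_coNP_iff`, `IsNPHard.compl_isHard_coNP`, `IsNPComplete.compl_isComplete_coNP` —
  the complement of an NP-hard (NP-complete) language is coNP-hard (coNP-complete)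
  (Arora–Barak 2009, Def. 2.20 and proof of Thm. 8.18: "if GI is NP-complete, then GNI is
  coNP-complete");
* `coNP_subset_AM_of_isNPHard_of_compl_mem_AM`, `coNP_subset_AM_iff_compl_mem_AM` — **`coNP ⊆ AM`
  iff `Lᶜ ∈ AM` for one (any) NP-complete `L`**, the first step of Boppana–Håstad–Zachos 1987
  (if `coNP ⊆ AM` then `PH` collapses) and the form in which "unless `coNP ⊆ AM`" no-go theorems
  (e.g. `Literature.Barriers.PneNP.NPHardnessToOneWayFunctions`, Akavia–Goldreich–Goldwasser–Moshkovitz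
  2006, Thm. 4) are proved: one exhibits an Arthur–Merlin protocol for the complement of a single
  NP-complete language.

## References

* S. Arora, B. Barak, *Computational Complexity: A Modern Approach*, CUP 2009, §7.6 (Def. 7.16,
  Def. 7.17 `BP·NP`, p. 137 of the printed book = PDF p. 169), Def. 8.10 and Remark 8.11
  (`AM[2] = BP·NP`), §8.2.4, Thm. 8.18 (proof), Def. 2.20.
* U. Schöning, *Probabilistic complexity classes and lowness*, JCSS 39 (1989) 84–100 (the `BP·`
  operator).
* R. Boppana, J. Håstad, S. Zachos, *Does co-NP have short interactive proofs?*, Inform. Process.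
  Lett. 25 (1987) 127–132, doi:10.1016/0020-0190(87)90232-8.
-/

namespace Literature.Computability.Complexity

open _root_.Computability Polynomial
open scoped Notation

/-! ### The `BP·` operator preserves closure under polynomial-time preimages -/

/-- **`BP·K` is closed under `FP` preimages when `K` is.** For `L ∈ bp K` with witness `L'' ∈ K`
and coin polynomial `p`, and `f ∈ FP` with `|f x| ≤ s(|x|)`, the language `f⁻¹(L)` has the witness
`(truncSndFn p ∘ mapFstFn f)⁻¹(L'') = {⟨x, y'⟩ | ⟨f x, y'↾p(|f x|)⟩ ∈ L''} ∈ K` and coin polynomial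
`p ∘ s`; the fraction of correct coin strings agrees by `uniformProb_take_of_le` (the verdict on
`y'` only depends on its prefix of length `p(|f x|) ≤ p(s(|x|))`). (Arora–Barak 2009, §7.6:
"if `C ∈ BPP` and `B ≤ᵣ C`, then `B ∈ BPP`", specialised to deterministic reductions and stated
for the operator; Schöning 1989.) [cite: AroraBarakCC2009, §7.6 (Def. 7.16–7.17)] -/
theorem preimage_mem_bp {K : Set (Language Bool)}
    (hK : ∀ ⦃L : Language Bool⦄, L ∈ K → ∀ ⦃g : List Bool → List Bool⦄, g ∈ FP → g ⁻¹' L ∈ K)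
    {L : Language Bool} (hL : L ∈ bp K) {f : List Bool → List Bool} (hf : f ∈ FP) :
    f ⁻¹' L ∈ bp K := by
  obtain ⟨L'', hL'', p, hp⟩ := hL
  obtain ⟨s, hs⟩ := exists_poly_length_le_of_mem_FP hf
  refine ⟨(truncSndFn p ∘ mapFstFn f) ⁻¹' L'',
    hK hL'' (comp_mem_FP (truncSndFn_mem_FP p) (mapFstFn_mem_FP hf)), p.comp s, fun x => ?_⟩
  set L₃ : Language Bool := (truncSndFn p ∘ mapFstFn f) ⁻¹' L'' with hL₃
  change 2 / 3 ≤ uniformProb ((p.comp s).eval x.length) {y : List Bool | boolPair x y ∈ L₃ ↔ f x ∈ L}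
  have hset : {y : List Bool | boolPair x y ∈ L₃ ↔ f x ∈ L} =
      {y | y.take (p.eval (f x).length) ∈ {y : List Bool | boolPair (f x) y ∈ L'' ↔ f x ∈ L}} := by
    ext y
    change (truncSndFn p (mapFstFn f (boolPair x y)) ∈ L'' ↔ f x ∈ L) ↔
      (boolPair (f x) (y.take (p.eval (f x).length)) ∈ L'' ↔ f x ∈ L)
    rw [mapFstFn_boolPair, truncSndFn_boolPair]
  rw [hset, eval_comp, uniformProb_take_of_le (TM2Iter.eval_mono p (hs x))]
  exact hp (f x)

/-! ### `BPP` and `AM` are closed downward under Karp reductions -/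

/-- **`BPP` is closed under polynomial-time preimages** (`BPP = BP·P`, `preimage_mem_P`).
[cite: AroraBarakCC2009, §7.6 (Def. 7.16)] -/
theorem preimage_mem_BPP {L : Language Bool} (hL : L ∈ BPP) {f : List Bool → List Bool}
    (hf : f ∈ FP) : f ⁻¹' L ∈ BPP :=
  preimage_mem_bp (fun _ hL _ hg => preimage_mem_P hL hg) hL hf

/-- **`BPP` is closed downward under Karp reductions**: `L₁ ≤ₚ L₂ ∈ BPP ⇒ L₁ ∈ BPP` ("if
`C ∈ BPP` and `B ≤ᵣ C`, then `B ∈ BPP`"; a Karp reduction is a randomized reduction that ignores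
its coins). [cite: AroraBarakCC2009, §7.6 (Def. 7.16)] -/
theorem mem_BPP_of_karpReducible {L₁ L₂ : Language Bool} (h : L₁ ≤ₚ L₂) (h₂ : L₂ ∈ BPP) :
    L₁ ∈ BPP := by
  obtain ⟨f, hf, hfL⟩ := h
  rw [show L₁ = f ⁻¹' L₂ from Set.ext hfL]
  exact preimage_mem_BPP h₂ hf

/-- If some NP-hard language is in `BPP` then `NP ⊆ BPP` (the probabilistic analogue of
`NP_subset_P_of_isNPHard_of_mem_P`). [cite: AroraBarakCC2009, §7.6 (Def. 7.16)] -/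
theorem NP_subset_BPP_of_isNPHard_of_mem_BPP {L : Language Bool} (h : IsNPHard L)
    (hL : L ∈ BPP) : Nondeterministic.NP ⊆ BPP :=
  fun L' hL' => mem_BPP_of_karpReducible (h L' hL') hL

/-- **`AM = BP·NP` is closed under polynomial-time preimages** (`preimage_mem_NP`).
[cite: AroraBarakCC2009, Def. 7.17 and Remark 8.11] -/
theorem preimage_mem_AM {L : Language Bool} (hL : L ∈ AM) {f : List Bool → List Bool}
    (hf : f ∈ FP) : f ⁻¹' L ∈ AM :=
  preimage_mem_bp (fun _ hL _ hg => preimage_mem_NP hL hg) hL hf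

/-- **`AM` is closed downward under Karp reductions**: `L₁ ≤ₚ L₂ ∈ AM ⇒ L₁ ∈ AM`
(`BP·NP = {L : L ≤ᵣ 3SAT}` is closed under `≤ₚ`, indeed under `≤ᵣ`).
[cite: AroraBarakCC2009, Def. 7.17 and Remark 8.11] -/
theorem mem_AM_of_karpReducible {L₁ L₂ : Language Bool} (h : L₁ ≤ₚ L₂) (h₂ : L₂ ∈ AM) :
    L₁ ∈ AM := by
  obtain ⟨f, hf, hfL⟩ := h
  rw [show L₁ = f ⁻¹' L₂ from Set.ext hfL]
  exact preimage_mem_AM h₂ hf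

/-! ### Complements of NP-complete languages are coNP-complete -/

/-- `Lᶜ ∈ coNP ↔ L ∈ NP` (`coNP = co NP`, `Lᶜᶜ = L`). [cite: AroraBarakCC2009, Def. 2.20] -/
theorem compl_mem_coNP_iff {L : Language Bool} : Lᶜ ∈ coNP ↔ L ∈ Nondeterministic.NP := by
  change Lᶜᶜ ∈ Nondeterministic.NP ↔ L ∈ Nondeterministic.NP
  rw [compl_compl]

/-- **The complement of an NP-hard language is coNP-hard**: every `L' ∈ coNP` has `L'ᶜ ∈ NP`,
so `L'ᶜ ≤ₚ L`, and the same reduction gives `L' ≤ₚ Lᶜ` (`karpReducible_compl_iff`).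
(Arora–Barak 2009, proof of Thm. 8.18: "If GI is NP-complete, then GNI is coNP-complete".)
[cite: AroraBarakCC2009, Thm. 8.18 (proof)] -/
theorem IsNPHard.compl_isHard_coNP {L : Language Bool} (h : IsNPHard L) : IsHard coNP Lᶜ := by
  intro L' hL'
  have h' : L'ᶜ ≤ₚ Lᶜᶜ := by
    rw [compl_compl]
    exact h L'ᶜ hL'
  exact karpReducible_compl_iff.1 h'

/-- **The complement of an NP-complete language is coNP-complete.**
[cite: AroraBarakCC2009, Thm. 8.18 (proof)] -/
theorem IsNPComplete.compl_isComplete_coNP {L : Language Bool} (h : IsNPComplete L) :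
    IsComplete coNP Lᶜ :=
  ⟨compl_mem_coNP_iff.2 h.mem, IsNPHard.compl_isHard_coNP h.isHard⟩

/-! ### `coNP ⊆ AM` iff the complement of an NP-complete language is in `AM` -/

/-- **If `Lᶜ ∈ AM` for an NP-hard `L`, then `coNP ⊆ AM`**: every `L' ∈ coNP` Karp-reduces to the
coNP-hard `Lᶜ` (`IsNPHard.compl_isHard_coNP`) and `AM` is closed downward under `≤ₚ`
(`mem_AM_of_karpReducible`). This is the step by which an Arthur–Merlin protocol for the
complement of ONE NP-complete language yields `coNP ⊆ AM` (Boppana–Håstad–Zachos 1987;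
Arora–Barak 2009, proof of Thm. 8.18), the form of the conclusion of
Akavia–Goldreich–Goldwasser–Moshkovitz 2006, Thm. 4. [cite: BoppanaHastadZachos1987]
[cite: AroraBarakCC2009, Thm. 8.18 (proof)] -/
theorem coNP_subset_AM_of_isNPHard_of_compl_mem_AM {L : Language Bool} (h : IsNPHard L)
    (hAM : Lᶜ ∈ AM) : coNP ⊆ AM :=
  fun L' hL' => mem_AM_of_karpReducible (IsNPHard.compl_isHard_coNP h L' hL') hAM

/-- **`coNP ⊆ AM ↔ Lᶜ ∈ AM` for every NP-complete `L`** (`→`: `Lᶜ ∈ coNP`; `←`: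
`coNP_subset_AM_of_isNPHard_of_compl_mem_AM`). [cite: BoppanaHastadZachos1987]
[cite: AroraBarakCC2009, Thm. 8.18 (proof)] -/
theorem coNP_subset_AM_iff_compl_mem_AM {L : Language Bool} (h : IsNPComplete L) :
    coNP ⊆ AM ↔ Lᶜ ∈ AM :=
  ⟨fun hsub => hsub (compl_mem_coNP_iff.2 h.mem),
    coNP_subset_AM_of_isNPHard_of_compl_mem_AM h.isHard⟩

end Literature.Computability.Complexity
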